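import Mathlib
import Summits.KontsevichZagierPeriods.Zeta5Search.BigPrimeDivisibility
import Summits.KontsevichZagierPeriods.Zeta5Search.CasoratianValuation
import Summits.KontsevichZagierPeriods.Zeta5Search.DualSeriesContiguity
import HarnessLib

/-!
# ζ(5) search — big-prime window of the Casoratian laws: `p ∣ W(b+e_j)V(b) − W(b)V(b+e_j)` and `p ∣ UW' − U'W`

Cell `pub-zeta5` (HONEST FRAMING: systematic search; no irrationality claim unless certified), typer seat
generation 7.  COROLLARIES of the big-prime divisibility theorem (W∞) (`BigPrimeDivisibility.lean`, found by the
gen-2 seat, REPORT-gen2-g5 §5e–§5f): for `b` and `b + e_j` in the Brown–Zudilin polytope and every prime `p` with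
`max(5, b₀+1) ≤ p ≤ d(b)` (so that `p ≤ d(b)+1` AND `p ≤ d(b+e_j)+1 = d(b)`), the ζ(3)-coefficients `W(b)`, `W(b+e_j)`
are divisible by `p` while ALL canonical coefficients `U, W, V` of both series are `p`-integral (every
partial-fraction coefficient has the `p`-free denominator `e₀(q)^6`, and the harmonic numbers `H_q^{(i)}`, `q ≤ b₀ < p`,
are `p`-integral); hence `p` divides the Casoratian `W(b+e_j)V(b) − W(b)V(b+e_j)` and the minor
`U(b)W(b+e_j) − U(b+e_j)W(b)` (`one_le_padicValRat_casoratian`, `one_le_padicValRat_minorQ`).  In that window the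
pair-floor terms of the OBSERVED laws (CV)/(QV) of `CasoratianValuation.lean` vanish and the refund is `1`, so these
are LITERALLY the big-prime cases of `CasoratianValuationLaw` and `QMinorValuationLaw`
(`casoratianValuationLaw_bigPrime`, `qMinorValuationLaw_bigPrime`); the laws at primes `p ≤ b₀` remain OBSERVED.
Tool: `p`-integrality is handled through `padicNorm` (`≤ 1`, resp. `≤ p⁻¹` for divisibility).

SCOPE (lead/lit g5, LITERATURE §I.33): the window `b₀ < p ≤ d(b)+1` of (W∞) is non-empty only when `Σ_j b_j ≤ 2b₀`
(structural theorem; it is EMPTY on every highly-ranked census direction — record ray `d = 25n < 41n = b₀`, H1 direction,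
symmetric ray — so it changes no NEAR-MISSES margin).  Nearest printed relatives: Krattenthaler–Rivoal 2007, Thms 3–6
(primes above the pole range dividing coefficients of the symmetric derived very-well-poised series); the 𝔽_p mechanism
(vanishing power sums up to the excess, Wilson's product) is folklore; the statement for the general `F̃₇(b)` and the
`U`-threshold `2p ≤ d+1` are the cell's (gen-2 g5).
-/

noncomputable section

open Finset

namespace Summit.KontsevichZagierPeriods.Zeta5Search.BigPrime

open Summit.KontsevichZagierPeriods.Zeta5Search.DualSeries (InBox sum_update)
open Summit.KontsevichZagierPeriods.Zeta5Search.WedgeDictionary (IsPFData coeffU coeffW coeffV coeffU_eq coeffW_eq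
  coeffV_eq exists_isPFData dOf)
open Summit.KontsevichZagierPeriods.Zeta5Search.CasoratianValuation (InPolytope shift casoratian minorQ refund
  pairFloors CasoratianValuationLaw QMinorValuationLaw)
open Literature.NumberTheory.Transcendental.BallRivoal (harm)

/-! ### `p`-integrality and divisibility through the `p`-adic norm -/

section Norm

variable {p : ℕ} [hp : Fact p.Prime]

/-- Cleared form ⟹ `p`-integral: `u·x = z`, `p ∤ u` ⟹ `‖x‖_p ≤ 1`. -/
theorem padicNorm_le_one_of_mul_eq {u z : ℤ} {x : ℚ} (hu : ¬ (p : ℤ) ∣ u) (h : (u : ℚ) * x = z) :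
    padicNorm p x ≤ 1 := by
  have hu0' : u ≠ 0 := fun h0 => hu (by rw [h0]; exact dvd_zero _)
  have hu0 : (u : ℚ) ≠ 0 := by exact_mod_cast hu0'
  have hx : x = (z : ℚ) / u := by rw [eq_div_iff hu0, mul_comm]; exact h
  rw [hx, padicNorm.div, (padicNorm.int_eq_one_iff u).2 hu, div_one]
  exact padicNorm.of_int z

/-- Cleared form ⟹ divisible: `u·x = z`, `p ∤ u`, `p ∣ z` ⟹ `‖x‖_p ≤ p⁻¹`. -/
theorem padicNorm_le_inv_of_mul_eq {u z : ℤ} {x : ℚ} (hu : ¬ (p : ℤ) ∣ u) (hz : (p : ℤ) ∣ z)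
    (h : (u : ℚ) * x = z) : padicNorm p x ≤ (p : ℚ)⁻¹ := by
  have hu0' : u ≠ 0 := fun h0 => hu (by rw [h0]; exact dvd_zero _)
  have hu0 : (u : ℚ) ≠ 0 := by exact_mod_cast hu0'
  have hx : x = (z : ℚ) / u := by rw [eq_div_iff hu0, mul_comm]; exact h
  rw [hx, padicNorm.div, (padicNorm.int_eq_one_iff u).2 hu, div_one, ← zpow_neg_one]
  exact (padicNorm.dvd_iff_norm_le (n := 1)).1 (by simpa using hz)

/-- `‖x‖_p ≤ p⁻¹` and `x ≠ 0` ⟹ `v_p(x) ≥ 1`. -/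
theorem one_le_padicValRat_of_padicNorm_le {x : ℚ} (hx : x ≠ 0) (h : padicNorm p x ≤ (p : ℚ)⁻¹) :
    1 ≤ padicValRat p x := by
  rw [padicNorm.eq_zpow_of_nonzero hx, ← zpow_neg_one] at h
  have hp1 : 1 < (p : ℚ) := by exact_mod_cast hp.out.one_lt
  have := (zpow_le_zpow_iff_right₀ hp1).1 h
  omega

/-- Products: `‖x‖ ≤ p⁻¹`, `‖y‖ ≤ 1` ⟹ `‖xy‖ ≤ p⁻¹`. -/
theorem padicNorm_mul_le_inv {x y : ℚ} (hx : padicNorm p x ≤ (p : ℚ)⁻¹) (hy : padicNorm p y ≤ 1) :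
    padicNorm p (x * y) ≤ (p : ℚ)⁻¹ := by
  rw [padicNorm.mul]
  calc padicNorm p x * padicNorm p y ≤ (p : ℚ)⁻¹ * 1 :=
        mul_le_mul hx hy (padicNorm.nonneg _) (by positivity)
    _ = (p : ℚ)⁻¹ := mul_one _

/-- Products of `p`-integral numbers are `p`-integral. -/
theorem padicNorm_mul_le_one {x y : ℚ} (hx : padicNorm p x ≤ 1) (hy : padicNorm p y ≤ 1) :
    padicNorm p (x * y) ≤ 1 := by
  rw [padicNorm.mul]
  calc padicNorm p x * padicNorm p y ≤ 1 * 1 := mul_le_mul hx hy (padicNorm.nonneg _) zero_le_one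
    _ = 1 := mul_one _

/-- The harmonic-type numbers `H_q^{(i)} = Σ_{m<q} (m+1)^{−i}` are `p`-integral for `q < p`… more precisely for `q ≤ n < p`. -/
theorem padicNorm_harm_le_one (i q : ℕ) (hq : q < p) : padicNorm p (harm i q) ≤ 1 := by
  rw [harm]
  refine padicNorm.sum_le' (fun m hm => ?_) zero_le_one
  have hm' : m + 1 < p := by have := mem_range.1 hm; omega
  have hnd : ¬ p ∣ m + 1 := fun h => absurd (Nat.le_of_dvd (by omega) h) (by omega)
  have hnd' : ¬ p ∣ (m + 1) ^ i := fun h => hnd (hp.out.dvd_of_dvd_pow h)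
  have h1 : padicNorm p (((m + 1) ^ i : ℕ) : ℚ) = 1 := (padicNorm.nat_eq_one_iff _).2 hnd'
  have hterm : (1 : ℚ) / ((m : ℚ) + 1) ^ i = 1 / (((m + 1) ^ i : ℕ) : ℚ) := by push_cast; ring
  rw [hterm, padicNorm.div, h1, div_one, padicNorm.one]

end Norm

/-! ### `p`-integrality of the canonical coefficients for `p > b₀` -/

section Integral

variable {p : ℕ} [hp : Fact p.Prime]

/-- Every partial-fraction coefficient `c_{o,q}` of `R_b` is `p`-integral for `p > b₀` (its denominator divides
`e₀(q)^6`, a product of sixth powers of differences of pole indices). -/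
theorem padicNorm_pf_le_one (b : ℕ → ℤ) (hb : InBox b) (hhalf : ∀ j ∈ range 7, 2 * b (j + 1) ≤ b 0 + 1)
    {c : ℕ → ℕ → ℚ} (hc : IsPFData b c) (hnp : (b 0).toNat < p) {q : ℕ} (hq : q ≤ (b 0).toNat) {o : ℕ}
    (ho : o < 6) : padicNorm p (c o q) ≤ 1 := by
  have h := pf_coeff_eq b hb hhalf hc hq ho
  have hu : ¬ (p : ℤ) ∣ e0Z (b 0).toNat q ^ 6 := fun hd =>
    not_dvd_e0Z hp.out hnp q hq ((Nat.prime_iff_prime_int.1 hp.out).dvd_of_dvd_pow hd)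
  exact padicNorm_le_one_of_mul_eq hu (by push_cast; exact h)

/-- `U(b)`, `W(b)`, `V(b)` are `p`-integral for every prime `p > b₀` (`b` in the box, `2b_j ≤ b₀+1`, `Σb_j ≤ 3b₀+1`). -/
theorem padicNorm_coeff_le_one (b : ℕ → ℤ) (hb : InBox b) (hhalf : ∀ j ∈ range 7, 2 * b (j + 1) ≤ b 0 + 1)
    (hsum : ∑ j ∈ range 7, b (j + 1) ≤ 3 * b 0 + 1) (hnp : (b 0).toNat < p) :
    padicNorm p (coeffU b) ≤ 1 ∧ padicNorm p (coeffW b) ≤ 1 ∧ padicNorm p (coeffV b) ≤ 1 := by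
  obtain ⟨c, hc⟩ := exists_isPFData b hb hsum
  have hcq : ∀ q ∈ range ((b 0).toNat + 1), ∀ o, o < 6 → padicNorm p (c o q) ≤ 1 := fun q hq o ho =>
    padicNorm_pf_le_one b hb hhalf hc hnp (Nat.lt_succ_iff.1 (mem_range.1 hq)) ho
  refine ⟨?_, ?_, ?_⟩
  · rw [coeffU_eq hc]
    exact padicNorm.sum_le' (fun q hq => hcq q hq 4 (by norm_num)) zero_le_one
  · rw [coeffW_eq hc]
    exact padicNorm.sum_le' (fun q hq => hcq q hq 2 (by norm_num)) zero_le_one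
  · rw [coeffV_eq hc]
    refine padicNorm.sum_le' (fun o ho => padicNorm.sum_le' (fun q hq => ?_) zero_le_one) zero_le_one
    exact padicNorm_mul_le_one (hcq q hq o (mem_range.1 ho))
      (padicNorm_harm_le_one _ _ (by have := mem_range.1 hq; omega))

/-- `‖W(b)‖_p ≤ p⁻¹` in the window of (W∞). -/
theorem padicNorm_coeffW_le_inv (b : ℕ → ℤ) (hb : InBox b)
    (h2 : ∀ i ∈ range 7, 2 * b (i + 1) ≤ b 0) (h3 : ∑ i ∈ range 7, b (i + 1) ≤ 3 * b 0)
    (hp5 : 5 ≤ p) (hpb : b 0 + 1 ≤ (p : ℤ)) (hpd : (p : ℤ) ≤ dOf b + 1) :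
    padicNorm p (coeffW b) ≤ (p : ℚ)⁻¹ := by
  obtain ⟨U, Z, hU, hZ, hUW⟩ := exists_clear_coeffW b p hb h2 h3 hp.out hp5 hpb hpd
  exact padicNorm_le_inv_of_mul_eq hU hZ hUW

end Integral

/-! ### The contiguous shift `b + e_j` -/

/-- `d(b + e_j) = d(b) − 1` for `1 ≤ j ≤ 7`. -/
theorem dOf_shift (b : ℕ → ℤ) {j : ℕ} (hj : 1 ≤ j) (hj' : j ≤ 7) : dOf (shift b j) = dOf b - 1 := by
  obtain ⟨i, rfl⟩ : ∃ i, j = i + 1 := ⟨j - 1, by omega⟩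
  have hi : i ∈ range 7 := mem_range.2 (by omega)
  unfold dOf shift
  rw [sum_update b hi, Function.update_of_ne (show (0 : ℕ) ≠ i + 1 by omega)]
  ring

/-- `(b + e_j)₀ = b₀` for `1 ≤ j`. -/
theorem shift_zero (b : ℕ → ℤ) {j : ℕ} (hj : 1 ≤ j) : shift b j 0 = b 0 := by
  unfold shift
  exact Function.update_of_ne (by omega) _ _

/-! ### The corollaries -/

section Corollaries

variable {p : ℕ} [hp : Fact p.Prime]

/-- Unpacking `InPolytope` for the integrality lemma. -/
theorem polytope_hyps (b : ℕ → ℤ) (hb : InPolytope b) :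
    InBox b ∧ (∀ j ∈ range 7, 2 * b (j + 1) ≤ b 0 + 1) ∧ (∑ j ∈ range 7, b (j + 1) ≤ 3 * b 0 + 1) :=
  ⟨hb.1, fun j hj => by have := hb.2.1 j hj; omega, by have := hb.2.2; omega⟩

/-- **Big-prime case of (CV).**  For `b`, `b + e_j` in the polytope and a prime `max(5, b₀+1) ≤ p ≤ d(b)`:
`p ∣ W(b+e_j)V(b) − W(b)V(b+e_j)`, i.e. `v_p(casoratian b j) ≥ 1`. -/
theorem one_le_padicValRat_casoratian (b : ℕ → ℤ) (j : ℕ) (hb : InPolytope b) (hj : 1 ≤ j) (hj' : j ≤ 7)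
    (hb' : InPolytope (shift b j)) (hp5 : 5 ≤ p) (hpb : b 0 + 1 ≤ (p : ℤ)) (hpd : (p : ℤ) ≤ dOf b)
    (hne : casoratian b j ≠ 0) : 1 ≤ padicValRat p (casoratian b j) := by
  obtain ⟨hbox, hhalf, hsum⟩ := polytope_hyps b hb
  obtain ⟨hbox', hhalf', hsum'⟩ := polytope_hyps _ hb'
  have h0 : 0 ≤ b 0 := hbox.1
  have hnp : (b 0).toNat < p := by omega
  have hnp' : (shift b j 0).toNat < p := by rw [shift_zero b hj]; exact hnp
  obtain ⟨-, -, hV⟩ := padicNorm_coeff_le_one (p := p) b hbox hhalf hsum hnp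
  obtain ⟨-, -, hV'⟩ := padicNorm_coeff_le_one (p := p) _ hbox' hhalf' hsum' hnp'
  have hW := padicNorm_coeffW_le_inv (p := p) b hbox hb.2.1 hb.2.2 hp5 hpb (by omega)
  have hW' := padicNorm_coeffW_le_inv (p := p) (shift b j) hbox' hb'.2.1 hb'.2.2 hp5
    (by rw [shift_zero b hj]; exact hpb) (by rw [dOf_shift b hj hj']; omega)
  refine one_le_padicValRat_of_padicNorm_le hne ?_
  rw [casoratian]
  exact padicNorm.sub.trans (max_le (padicNorm_mul_le_inv hW' hV) (padicNorm_mul_le_inv hW hV'))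

/-- **Big-prime case of (QV).**  Same window: `p ∣ U(b)W(b+e_j) − U(b+e_j)W(b)`, i.e. `v_p(minorQ b j) ≥ 1`. -/
theorem one_le_padicValRat_minorQ (b : ℕ → ℤ) (j : ℕ) (hb : InPolytope b) (hj : 1 ≤ j) (hj' : j ≤ 7)
    (hb' : InPolytope (shift b j)) (hp5 : 5 ≤ p) (hpb : b 0 + 1 ≤ (p : ℤ)) (hpd : (p : ℤ) ≤ dOf b)
    (hne : minorQ b j ≠ 0) : 1 ≤ padicValRat p (minorQ b j) := by
  obtain ⟨hbox, hhalf, hsum⟩ := polytope_hyps b hb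
  obtain ⟨hbox', hhalf', hsum'⟩ := polytope_hyps _ hb'
  have h0 : 0 ≤ b 0 := hbox.1
  have hnp : (b 0).toNat < p := by omega
  have hnp' : (shift b j 0).toNat < p := by rw [shift_zero b hj]; exact hnp
  obtain ⟨hU, -, -⟩ := padicNorm_coeff_le_one (p := p) b hbox hhalf hsum hnp
  obtain ⟨hU', -, -⟩ := padicNorm_coeff_le_one (p := p) _ hbox' hhalf' hsum' hnp'
  have hW := padicNorm_coeffW_le_inv (p := p) b hbox hb.2.1 hb.2.2 hp5 hpb (by omega)
  have hW' := padicNorm_coeffW_le_inv (p := p) (shift b j) hbox' hb'.2.1 hb'.2.2 hp5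
    (by rw [shift_zero b hj]; exact hpb) (by rw [dOf_shift b hj hj']; omega)
  refine one_le_padicValRat_of_padicNorm_le hne ?_
  rw [minorQ]
  refine padicNorm.sub.trans (max_le ?_ ?_)
  · rw [mul_comm]; exact padicNorm_mul_le_inv hW' hU
  · rw [mul_comm]; exact padicNorm_mul_le_inv hW hU'

/-- In the big-prime window the pair-floor sum of the OBSERVED laws vanishes … -/
theorem pairFloors_eq_zero (b : ℕ → ℤ) (hb : InPolytope b) {p : ℕ} (hpb : b 0 + 1 ≤ (p : ℤ)) :
    pairFloors b p = 0 := by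
  rw [pairFloors]
  refine sum_eq_zero fun i hi => sum_eq_zero fun k hk => ?_
  split_ifs with hik
  · have hi0 := (hb.1.2 i hi).1
    have hk0 := (hb.1.2 k hk).1
    have : b 0 - b (i + 1) - b (k + 1) < (p : ℤ) := by omega
    rcases lt_or_ge (b 0 - b (i + 1) - b (k + 1)) 0 with hneg | hnonneg
    · -- a negative block length: the floor is still `0` only when …; but in the polytope `b_i + b_k ≤ b₀`.
      have := hb.2.1 i hi; have := hb.2.1 k hk; omega
    · exact Int.ediv_eq_zero_of_lt hnonneg this
  · rfl

/-- … and the refund is `1` (`p ≤ d(b)`). -/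
theorem refund_eq_one (b : ℕ → ℤ) {p : ℕ} (hp : 0 < p) (hpd : (p : ℤ) ≤ dOf b) : refund b p = 1 := by
  rw [refund, min_eq_left_iff]
  exact (Int.le_ediv_iff_mul_le (by exact_mod_cast hp)).2 (by simpa using hpd)

/-- **(CV) holds in the big-prime window** `max(5, b₀+1) ≤ p ≤ d(b)`: literally the inequality of
`CasoratianValuationLaw` (whose pair-floor sum is `0` and refund `1` there). -/
theorem casoratianValuationLaw_bigPrime (b : ℕ → ℤ) (j p : ℕ) (hb : InPolytope b) (hj : 1 ≤ j) (hj' : j ≤ 7)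
    (hb' : InPolytope (shift b j)) (hprime : p.Prime) (hp5 : 5 ≤ p) (hpb : b 0 + 1 ≤ (p : ℤ))
    (hpd : (p : ℤ) ≤ dOf b) (hne : casoratian b j ≠ 0) :
    refund b p - pairFloors b p ≤ padicValRat p (casoratian b j) := by
  haveI : Fact p.Prime := ⟨hprime⟩
  rw [refund_eq_one b hprime.pos hpd, pairFloors_eq_zero b hb hpb, sub_zero]
  exact one_le_padicValRat_casoratian b j hb hj hj' hb' hp5 hpb hpd hne

/-- **(QV) holds in the big-prime window** `max(5, b₀+1) ≤ p ≤ d(b)`. -/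
theorem qMinorValuationLaw_bigPrime (b : ℕ → ℤ) (j p : ℕ) (hb : InPolytope b) (hj : 1 ≤ j) (hj' : j ≤ 7)
    (hb' : InPolytope (shift b j)) (hprime : p.Prime) (hp5 : 5 ≤ p) (hpb : b 0 + 1 ≤ (p : ℤ))
    (hpd : (p : ℤ) ≤ dOf b) (hne : minorQ b j ≠ 0) :
    refund b p - pairFloors b p ≤ padicValRat p (minorQ b j) := by
  haveI : Fact p.Prime := ⟨hprime⟩
  rw [refund_eq_one b hprime.pos hpd, pairFloors_eq_zero b hb hpb, sub_zero]
  exact one_le_padicValRat_minorQ b j hb hj hj' hb' hp5 hpb hpd hne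

end Corollaries

end Summit.KontsevichZagierPeriods.Zeta5Search.BigPrime

end
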